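import Summits.QuantumFields.BalabanUV.Beta.GAN24.ExitFaceLeftFamily
import Summits.QuantumFields.BalabanUV.Beta.GAN24.PeriodicForceMultiplier

/-!
# `BalabanUV.Beta.GAN24.ExitFaceRightFamily` — binder row G-an2-4 ∕ (CONV-C), W-slot (α-0), ROW (C) AT LEVELS `j ≥ 1`, letter (W5)-R of the (γ) hand's memo
# `HOME/b2b-balaban-gan24-formalise-leaf-06/g52/C-LEVELS-GE1.md` §19 step (1)∕(3): **THE BACKGROUND-RESUMMED, EXIT-FACE-READ RIGHT HALF-VERTEX
# `t_R(b, z) := Σ'_{u′} Σ'_w χ_β(w)·vertexOfK X̃♮_j Lc (unitS sf sm S) ν u′ z w (inl b)(inl β)` FOR A GENERIC LOCAL STENCIL FAMILY `S`: it is `Lc`-periodic in `z`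
# (block covariance), hence bounded, and it equals the two-face sum `c₀σ_j·Σ'_w χ_β(w)·Σ'_t χ_ν(t)·(unitS sf sm S) ν t z w (inl b)(inl β)`** — the twin, with the face on the SECOND
# slot, of (W5) `ExitFaceLeftFamily.tsum_leftFamily_eq_faceface`; every `j`, in-block root `toSite r`, every `d`, `Lc ≥ 1`
# (G-an2-4 CRUX TEAM (2), seat `b2b-balaban-gan24-formalise-leaf-06` = the (γ) hand, gen 52; journal INTENT I-leaf06-g52-10)

NOT IN PRINT; OUR BOOKKEEPING ([folklore] `tsum` bookkeeping BY NAME over an2's `OneStepKernelFamily.vertexOfK_translate` ∕ `vertexFamily_vertexOfK`, leaf-04's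
`EEWordReduced.shiftK_dressedStep`, `DressedHalfVertex.hasSum_vertexOfK_dressedStep`, `PeriodicForceMultiplier.bounded_of_periodic` and (W5)'s `unitS_translate_of_translate`;
0 `def`, 0 cited fact, 0 `def … : Prop`, 0 sorry).
HONEST FRAMING (cell contract, verbatim): «discharging `BetaPertH` makes Bałaban's UV stability UNCONDITIONAL — a real constructive-QFT result; it is NOT the continuum
limit and NOT the Clay problem.»  HONEST DEPENDENCY (verbatim): «continuum YM on T⁴ ⇐ BetaPertH ∧ nine spine estimates (0/9 proved); BetaPertH ⇐ (D1) ∧ (D4) ∧ CAP+tail;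
G-an2-4 gates asym, D1 and NE2/3/4.»
* §1 **`rightFamily_translate`** (`t_R(b, z + Lc•t) = t_R(b, z)` for a fine-translation-covariant `S` — a double re-indexing, no summability), `exists_abs_rightFamily_le`
  (hence bounded: `bounded_of_periodic`).
* §2 **`tsum_rightFamily_eq_faceface`** — the bond resummation (joint summability of `(u′, w) ↦ χ_β(w)·V ν u′ z w` from the `VertexFamily` bound, Fubini, then
  `hasSum_vertexOfK_dressedStep` pointwise in `w`).
USE: the right factor of leaf-04's reduced EE word (`EEWordReduced.ee_word_reduced`, there at level 0 for the Wilson table) at every level and for the level-`j` E-sector table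
`cE • e3OfK Lc G_j (SrecAt … j)` (fine-translation covariant by `ValueJetGeneric.e3OfK_translate`); with `ExchangeE2E2ChannelTools.faceface_unitS_smul` and
`ExitFaceHalfVertexSplit.faceface_e3OfK_split` it becomes `c₀σ K_c·[Lc⁻¹τ_R − (2Lc)⁻¹e_R]`. Asserts NO value of Bałaban's tables; discharges NOTHING of (C) ∕ (C)sym ∕ (Q-L) ∕ «T2Shape» ∕
«T2Drift» ∕ (hW, hWall); NEVER «G-an2-4 closed» as (CONV-C); NOT D1, NOT `BetaPertH`, NOT continuum, NOT Clay.  2026-08-23; no existing file touched.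
-/

noncomputable section

open Finset
open scoped BigOperators
open Literature.MathematicalPhysics.QuantumFieldTheory
open Literature.MathematicalPhysics.QuantumFieldTheory.Balaban1983to89
open Literature.MathematicalPhysics.QuantumFieldTheory.Balaban1983to89.Beta
open B12Sec2to5 (l1 l1_nonneg)
open ExpKernelCalculus (Site MKer shiftK Decays BiLoc VertexFamily Zl summable_exp_shift summable_exp_shift' l1_sub_symm)
open OneStepResolventKernel (Fib LocStencil)
open OneStepKernelFamily (KInvStep vertexOfK vertexOfK_translate vertexFamily_vertexOfK decays_KInvStep)
open AffineAveraging (Form1 box toSite)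
open Summit.QuantumFields.BalabanUV.Beta.AxialDressingRooted (coDressKBmAt decays_coDressKBmAt)
open Summit.QuantumFields.BalabanUV.Beta.HessKerDressedUnits (unitK unitS decays_unitK locStencil_unitS)
open Summit.QuantumFields.BalabanUV.Beta.GAN24.EEWordReduced (shiftK_dressedStep)
open Summit.QuantumFields.BalabanUV.Beta.GAN24.DressedHalfVertex (hasSum_vertexOfK_dressedStep)
open Summit.QuantumFields.BalabanUV.Beta.GAN24.PeriodicForceMultiplier (bounded_of_periodic)
open Summit.QuantumFields.BalabanUV.Beta.GAN24.ExitFaceLeftFamily (unitS_translate_of_translate)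

namespace Summit.QuantumFields.BalabanUV.Beta.GAN24.ExitFaceRightFamily

variable {d : ℕ} {Lc : ℕ} [NeZero Lc] {r : Fin (d + 1) → ℕ}
variable {S : Fin (d + 1) → (Fin (d + 1) → ℤ) → MKer (d + 1) (Fib d)}
variable {ν β : Fin (d + 1)}

/-! ## §1 Block periodicity and boundedness of the resummed right family -/

/-- [folklore] **THE RESUMMED RIGHT FAMILY IS `Lc`-PERIODIC** (fine-translation-covariant `S`): `t_R(b, z + Lc•t) = t_R(b, z)` — re-index `u′ ↦ u′ + t`, `w ↦ w + Lc•t` and use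
the covariance of the chain-rule vertex (`vertexOfK_translate` over `shiftK_dressedStep`). -/
theorem rightFamily_translate (hLc : 1 ≤ Lc) (hSt : ∀ (κ : Fin (d + 1)) (u v : Fin (d + 1) → ℤ), S κ (u + v) = shiftK (-v) (S κ u)) (sf sm : ℝ) (j : ℕ)
    (b : Fin (d + 1)) (z t : Site (d + 1)) :
    (∑' u' : Site (d + 1), ∑' w : Site (d + 1), (if w β % (Lc : ℤ) = (Lc : ℤ) - 1 then (1 : ℝ) else 0) *
        vertexOfK (unitK sf sm (coDressKBmAt (toSite r) Lc (KInvStep (d := d) Lc j))) Lc (unitS sf sm S) ν u' (z + (Lc : ℤ) • t) w (Sum.inl b) (Sum.inl β)) =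
      ∑' u' : Site (d + 1), ∑' w : Site (d + 1), (if w β % (Lc : ℤ) = (Lc : ℤ) - 1 then (1 : ℝ) else 0) *
        vertexOfK (unitK sf sm (coDressKBmAt (toSite r) Lc (KInvStep (d := d) Lc j))) Lc (unitS sf sm S) ν u' z w (Sum.inl b) (Sum.inl β) := by
  set V := vertexOfK (unitK sf sm (coDressKBmAt (toSite r) Lc (KInvStep (d := d) Lc j))) Lc (unitS sf sm S) with hVdef
  have hV : ∀ (u' x y : Site (d + 1)), V ν (u' + t) x y (Sum.inl b) (Sum.inl β) = V ν u' (x + -((Lc : ℤ) • t)) (y + -((Lc : ℤ) • t)) (Sum.inl b) (Sum.inl β) := by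
    intro u' x y
    have h := vertexOfK_translate (N := Lc) (shiftK_dressedStep (r := r) hLc sf sm j) (unitS_translate_of_translate hSt sf sm) ν u' t
    rw [hVdef, h]
    rfl
  have hχ : ∀ w : Site (d + 1), (if (w + (Lc : ℤ) • t) β % (Lc : ℤ) = (Lc : ℤ) - 1 then (1 : ℝ) else 0) = (if w β % (Lc : ℤ) = (Lc : ℤ) - 1 then (1 : ℝ) else 0) := by
    intro w
    simp only [Pi.add_apply, Pi.smul_apply, smul_eq_mul, Int.add_mul_emod_self_left]
  rw [← (Equiv.addRight t).tsum_eq (fun u' : Site (d + 1) => ∑' w : Site (d + 1), (if w β % (Lc : ℤ) = (Lc : ℤ) - 1 then (1 : ℝ) else 0) *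
    V ν u' (z + (Lc : ℤ) • t) w (Sum.inl b) (Sum.inl β))]
  refine tsum_congr fun u' => ?_
  rw [Equiv.coe_addRight, ← (Equiv.addRight ((Lc : ℤ) • t)).tsum_eq (fun w : Site (d + 1) => (if w β % (Lc : ℤ) = (Lc : ℤ) - 1 then (1 : ℝ) else 0) *
    V ν (u' + t) (z + (Lc : ℤ) • t) w (Sum.inl b) (Sum.inl β))]
  refine tsum_congr fun w => ?_
  rw [Equiv.coe_addRight, hχ, hV, add_neg_cancel_right, add_neg_cancel_right]

/-- [folklore] **THE RESUMMED RIGHT FAMILY IS BOUNDED** (periodic ⇒ bounded by its cell values, `bounded_of_periodic`; uniform in the leg `b` by summing over legs). -/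
theorem exists_abs_rightFamily_le (hLc : 1 ≤ Lc) (hSt : ∀ (κ : Fin (d + 1)) (u v : Fin (d + 1) → ℤ), S κ (u + v) = shiftK (-v) (S κ u)) (sf sm : ℝ) (j : ℕ) :
    ∃ M : ℝ, ∀ (b : Fin (d + 1)) (z : Site (d + 1)),
      |∑' u' : Site (d + 1), ∑' w : Site (d + 1), (if w β % (Lc : ℤ) = (Lc : ℤ) - 1 then (1 : ℝ) else 0) *
          vertexOfK (unitK sf sm (coDressKBmAt (toSite r) Lc (KInvStep (d := d) Lc j))) Lc (unitS sf sm S) ν u' z w (Sum.inl b) (Sum.inl β)| ≤ M := by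
  set T : Fin (d + 1) → Site (d + 1) → ℝ := fun b z => ∑' u' : Site (d + 1), ∑' w : Site (d + 1), (if w β % (Lc : ℤ) = (Lc : ℤ) - 1 then (1 : ℝ) else 0) *
    vertexOfK (unitK sf sm (coDressKBmAt (toSite r) Lc (KInvStep (d := d) Lc j))) Lc (unitS sf sm S) ν u' z w (Sum.inl b) (Sum.inl β) with hT
  refine ⟨∑ b : Fin (d + 1), ∑ x ∈ box (d + 1) Lc, |T b (toSite x)|, fun b z => ?_⟩
  have hb := bounded_of_periodic (Lc := Lc) (V := T b) (fun y t => rightFamily_translate (ν := ν) (β := β) hLc hSt sf sm j b y t) z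
  exact hb.trans (Finset.single_le_sum (f := fun b => ∑ x ∈ box (d + 1) Lc, |T b (toSite x)|)
    (fun b _ => Finset.sum_nonneg fun x _ => abs_nonneg _) (Finset.mem_univ b))

/-! ## §2 Bond resummation of the right family -/

/-- [folklore] **THE BOND-RESUMMED RIGHT FAMILY IS THE TWO-FACE HALF-VERTEX** (generic `S`, every `j`; face on the SECOND slot):
`Σ'_{u′} Σ'_w χ_β(w)·vertexOfK X̃♮_j Lc (unitS sf sm S) ν u′ z w (inl b)(inl β) = c₀σ_j·Σ'_w χ_β(w)·Σ'_t χ_ν(t)·(unitS sf sm S) ν t z w (inl b)(inl β)`,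
`c₀σ_j = (Lc·s_m s_f)·((Lc^{j+1})^{d+2})⁻¹`. -/
theorem tsum_rightFamily_eq_faceface (hLc : 1 ≤ Lc) (hr : r ∈ box (d + 1) Lc) {Cs δs : ℝ} (hS : LocStencil S Cs δs) (hδs : 0 < δs) (sf sm : ℝ) (j : ℕ)
    (b : Fin (d + 1)) (z : Site (d + 1)) :
    ∑' u : Site (d + 1), ∑' w : Site (d + 1), (if w β % (Lc : ℤ) = (Lc : ℤ) - 1 then (1 : ℝ) else 0) *
        vertexOfK (unitK sf sm (coDressKBmAt (toSite r) Lc (KInvStep (d := d) Lc j))) Lc (unitS sf sm S) ν u z w (Sum.inl b) (Sum.inl β) =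
      ((Lc : ℝ) * (sm * sf)) * ((((Lc ^ (j + 1) : ℕ) : ℝ)) ^ (d + 1 + 1))⁻¹ *
        ∑' w : Site (d + 1), (if w β % (Lc : ℤ) = (Lc : ℤ) - 1 then (1 : ℝ) else 0) *
          ∑' t : Site (d + 1), (if t ν % (Lc : ℤ) = (Lc : ℤ) - 1 then unitS sf sm S ν t z w (Sum.inl b) (Sum.inl β) else 0) := by
  obtain ⟨δK, CK, hδK, hCK, hXd⟩ := decays_coDressKBmAt hLc hr (decays_KInvStep (d := d) (Lc := Lc) j)
  have hXu := decays_unitK (sf := sf) (sm := sm) hXd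
  have hSu := locStencil_unitS (sf := sf) (sm := sm) hS
  have hC : 0 ≤ max |sf| |sm| * CK * max |sf| |sm| := by positivity
  set m : ℝ := min δK δs with hm
  have hm0 : 0 < m := lt_min hδK hδs
  have hCs' : 0 ≤ |(sf * sm)⁻¹| * (max |sf⁻¹| |sm⁻¹| * Cs * max |sf⁻¹| |sm⁻¹|) := by
    have : 0 ≤ Cs := (hS 0 0).nonneg (Sum.inl 0)
    positivity
  have hSm : LocStencil (unitS sf sm S) (|(sf * sm)⁻¹| * (max |sf⁻¹| |sm⁻¹| * Cs * max |sf⁻¹| |sm⁻¹|)) m :=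
    BalabanStepJets.locStencil_mono hSu hCs' (min_le_right _ _)
  obtain ⟨Cv, hVF⟩ : ∃ Cv : ℝ, VertexFamily (vertexOfK (unitK sf sm (coDressKBmAt (toSite r) Lc (KInvStep (d := d) Lc j))) Lc (unitS sf sm S)) Lc Cv (m / 2) :=
    ⟨_, vertexFamily_vertexOfK (N := Lc) hXu hC hSm hm0 (min_le_left _ _)⟩
  set V := vertexOfK (unitK sf sm (coDressKBmAt (toSite r) Lc (KInvStep (d := d) Lc j))) Lc (unitS sf sm S) with hVdef
  have hCv0 : 0 ≤ Cv := (hVF ν 0).nonneg (Sum.inl 0)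
  set δ₂ : ℝ := m / 2 with hδ₂
  have hδ₂0 : 0 < δ₂ := half_pos hm0
  -- joint summability of `(u, y) ↦ χ_α(y)·V μ u y z`: majorant `Cv·e^{−δ₂|y − Lc•u|}·e^{−δ₂|z − Lc•u|}`
  set F : Site (d + 1) × Site (d + 1) → ℝ := fun q => (if q.2 β % (Lc : ℤ) = (Lc : ℤ) - 1 then (1 : ℝ) else 0) * V ν q.1 z q.2 (Sum.inl b) (Sum.inl β) with hF
  have hFle : ∀ q : Site (d + 1) × Site (d + 1), |F q| ≤ (Cv * Real.exp (-δ₂ * l1 (z - (Lc : ℤ) • q.1))) * Real.exp (-δ₂ * l1 (q.2 - (Lc : ℤ) • q.1)) := by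
    intro q
    rw [hF, abs_mul]
    have h1 : |(if q.2 β % (Lc : ℤ) = (Lc : ℤ) - 1 then (1 : ℝ) else 0)| ≤ 1 := by split_ifs <;> simp
    have h2 := hVF ν q.1 z q.2 (Sum.inl b) (Sum.inl β)
    calc |(if q.2 β % (Lc : ℤ) = (Lc : ℤ) - 1 then (1 : ℝ) else 0)| * |V ν q.1 z q.2 (Sum.inl b) (Sum.inl β)|
        ≤ 1 * (Cv * Real.exp (-δ₂ * (l1 (z - (Lc : ℤ) • q.1) + l1 (q.2 - (Lc : ℤ) • q.1)))) := mul_le_mul h1 h2 (abs_nonneg _) zero_le_one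
      _ = _ := by rw [one_mul, mul_add, Real.exp_add]; ring
  -- inner sum in `y` for fixed `u`, then the `u` sum: `Σ_u e^{−δ₂|z − Lc u|}·Zl`
  have hin : ∀ u : Site (d + 1), HasSum (fun y : Site (d + 1) => (Cv * Real.exp (-δ₂ * l1 (z - (Lc : ℤ) • u))) * Real.exp (-δ₂ * l1 (y - (Lc : ℤ) • u)))
      ((Cv * Real.exp (-δ₂ * l1 (z - (Lc : ℤ) • u))) * Zl (d + 1) δ₂) := by
    intro u
    have h := (summable_exp_shift' hδ₂0 ((Lc : ℤ) • u)).hasSum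
    rw [show (∑' y : Site (d + 1), Real.exp (-δ₂ * l1 (y - (Lc : ℤ) • u))) = Zl (d + 1) δ₂ from by
      rw [← ExpKernelCalculus.tsum_exp_shift ((Lc : ℤ) • u)]; exact tsum_congr fun y => by rw [l1_sub_symm]] at h
    exact h.mul_left _
  have hout : Summable fun u : Site (d + 1) => (Cv * Real.exp (-δ₂ * l1 (z - (Lc : ℤ) • u))) * Zl (d + 1) δ₂ := by
    have hsub := (summable_exp_shift hδ₂0 z).comp_injective (InterLevelTransport.sublattice_injective Lc (0 : Site (d + 1)))
    refine ((hsub.mul_left Cv).mul_right (Zl (d + 1) δ₂)).congr fun u => ?_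
    simp only [Function.comp_apply, add_zero]
  have hM0 : Summable fun q : Site (d + 1) × Site (d + 1) => (Cv * Real.exp (-δ₂ * l1 (z - (Lc : ℤ) • q.1))) * Real.exp (-δ₂ * l1 (q.2 - (Lc : ℤ) • q.1)) := by
    refine (summable_prod_of_nonneg fun q => by positivity).2 ⟨fun u => (hin u).summable, ?_⟩
    exact hout.congr fun u => ((hin u).tsum_eq).symm
  have hFs : Summable F := Summable.of_norm_bounded hM0 fun q => by rw [Real.norm_eq_abs]; exact hFle q
  -- Fubini: `Σ'_u Σ'_y F (u,y) = Σ'_y Σ'_u F (u,y)`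
  have hcomm : (∑' u : Site (d + 1), ∑' w : Site (d + 1), (if w β % (Lc : ℤ) = (Lc : ℤ) - 1 then (1 : ℝ) else 0) * V ν u z w (Sum.inl b) (Sum.inl β)) =
      ∑' w : Site (d + 1), ∑' u : Site (d + 1), (if w β % (Lc : ℤ) = (Lc : ℤ) - 1 then (1 : ℝ) else 0) * V ν u z w (Sum.inl b) (Sum.inl β) :=
    (Summable.tsum_comm (f := fun u w => (if w β % (Lc : ℤ) = (Lc : ℤ) - 1 then (1 : ℝ) else 0) * V ν u z w (Sum.inl b) (Sum.inl β)) hFs).symm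
  rw [hcomm, ← tsum_mul_left]
  refine tsum_congr fun w => ?_
  rw [tsum_mul_left, hVdef, (hasSum_vertexOfK_dressedStep hLc hr sf sm j ν hSu hδs z w (Sum.inl b) (Sum.inl β)).tsum_eq]
  ring


end Summit.QuantumFields.BalabanUV.Beta.GAN24.ExitFaceRightFamily

end
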